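import Literature.Algebra.Homology.TateNakayamaInflationVanishingTorsion
import HarnessLib

/-!
# Quotient layers of a class-formation tower: the tower law `Inf u₂ = d·u₁` and Milne's Lemma 1.9
# vanishing (on `ℓ`-parts) pass from `(C₂ → C₁)` to compatible quotients `(A₂ → A₁)`
# (Harari Thm. 17.2 / Def. 15.38: `C_S = C / U_S`; Milne ADT I Lemma 1.9; Serre, *Local Fields* XI §3)

Topic `Algebra/Homology`; namespace `Literature.Algebra.Homology`.  Theorems only; no definition, no named
fact, no instance, no `sorry`.  Sequel of `TateNakayamaInflationVanishingTorsion` (the `ℓ`-part engine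
`IsClassModule.map_eq_zero_of_nsmul_eq_zero_plain`) and `ClassModule` (`IsClassModule.of_card`, `.res`,
`.addOrderOf_H2π`, `H2π_mapCocycles₂_subtype`).

THE SETTING.  Two layers of a formation: groups `π : G₁ → G₂` (the deeper layer maps onto the shallower one),
modules `C₂ ∈ Rep G₂`, `C₁ ∈ Rep G₁` with the layer map `ι : Res_π C₂ → C₁` (for the idèle class formation:
`Gal(M/F) ↠ Gal(E/F)`, `C_E → C_M`); and QUOTIENT LAYERS `q₂ : C₂ → A₂`, `q₁ : C₁ → A₁` with a layer map
`j : Res_π A₂ → A₁` making the square commute, `j ∘ q₂ = q₁ ∘ ι` (for Harari's `S`-idèle class formation,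
Def. 15.38 / Thm. 17.2: `A = C_S(·) = C_· / U_{·,S}`, the quotient of the idèle class group by the idèle units off
`S`).  Then (§1) inflation commutes with the quotient maps on every `Hⁿ`, so the TOWER LAW transfers: if
`Inf_ι [φ₂] = d · [φ₁]` in `H²(G₁, C₁)` then `Inf_j [q₂ ∘ φ₂] = d · [q₁ ∘ φ₁]` in `H²(G₁, A₁)` (Serre XI §3
«`Inf(u_{F/E}) = [F':F]. u_{F'/E}`» is inherited by the quotient formation); (§2) the same after restriction to
subgroups `H₁ ≤ G₁`, `H₂ ≤ G₂` with `π(H₁) ≤ H₂` (the relative layers `H_E ≤ Gal(E/F)` cut out by an open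
subgroup, Harari Lemma 16.20 at `U`); (§3) over `ℤ` with `G₂` finite: if `A₂` satisfies the class-module axioms
numerically (`H¹(U, A₂) = 0`, `#H²(U, A₂) = #U` for all `U ≤ G₂` — Harari's proof of Thm. 17.2: «the cohomology
groups `H^i(G_S, C^{H_S})` identify with the `H^i(G_S, C_S)` for `i ≥ 1`») and `q₂` is injective on `H²(G₂, ·)`,
then `(A₂, [q₂ ∘ φ₂])` IS a class module (`IsClassModule.quotientLayer_of_card`), and the `ℓ`-part engine applies
to the quotient tower: **every class of `Hⁿ⁺³(G₂, A₂)` (resp. `Hⁿ⁺³(H₂, Res A₂)`) killed by `e` dies under `Inf_j`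
as soon as `e ∣ d`** (`IsClassModule.map_quotientLayer_eq_zero_of_nsmul_eq_zero`, `…_res_…`).

USE (cell `bsd-eis`, background lane «PT-Ш-S-TC» of crux `GoodLatticeBDPValue`, stmt-BirchSwinnertonDyer-19032):
with `C = C_E ↠ A = C_S(E) = IdeleCohomology.classModUnitsRep F E S` at the finite Galois layers INSIDE `K_S` and the
canonical fundamental classes of the idèle class tower (`IdeleClassFundamentalClassTower`: `Inf u_E = [M:E]·u_M`), these
are the layer statements whose colimit is the field `ext_triv_eq_zero_of_nsmul_eq_zero` (`Hʳ(U, C̄_S)` has no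
`p`-torsion, `r ≥ 3`) of the `p`-primary duality hypotheses `TateDualityHypothesesAt p (C̄_S) (inv_S)` — inside `K_S`
only the layers with `p^a ∣ [M:E]` are available (cyclotomic layers), which is exactly what the `ℓ`-part engine needs.
Seat bsd-line-x1-p1-w4 g19.  HONEST FRAMING: finite-group cohomology only; no arithmetic statement, no duality
theorem and no case of BSD is proved here.

## References
* J. S. Milne, *Arithmetic Duality Theorems* (2nd ed. 2006), I §1 Lemma 1.9; I §4 (the `S`-idèle class formation
  `C_S = lim C_{F,S}`, a `P`-class formation). [MilneADT2006]
* D. Harari, *Galois Cohomology and Class Field Theory* (2020), Def. 15.38, Prop. 15.40, §16.3 Lemma 16.20,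
  §17.1 Thm. 17.2 (and its proof). [Harari2020]
* J.-P. Serre, *Local Fields*, GTM 67 (1979), XI §3 (`Inf(u_{F/E}) = [F':F]·u_{F'/E}`). [SerreLocalFields1979]
-/

noncomputable section

open CategoryTheory CategoryTheory.Limits groupCohomology

universe u

namespace Literature.Algebra.Homology

/-! ## §1 Inflation commutes with the quotient maps; the tower law transfers to the quotient layers -/

section General

variable {k : Type u} [CommRing k] {G₁ G₂ : Type u} [Group G₁] [Group G₂] (π : G₁ →* G₂)
  {C₂ A₂ : Rep.{u} k G₂} {C₁ A₁ : Rep.{u} k G₁}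
  (ι : Rep.res π C₂ ⟶ C₁) (q₂ : C₂ ⟶ A₂) (q₁ : C₁ ⟶ A₁) (j : Rep.res π A₂ ⟶ A₁)
  (hsq : ∀ c : C₂.V, j.hom (q₂.hom c) = q₁.hom (ι.hom c))

include hsq in
/-- **Inflation commutes with the quotient maps on `Hⁿ`**: `Hⁿ(q₂) ≫ Inf_j = Inf_ι ≫ Hⁿ(q₁)` when
`j ∘ q₂ = q₁ ∘ ι` (Mathlib's `groupCohomology.map_comp` on both sides: both composites are `Hⁿ` along `π` of the
pair map `q₁ ∘ ι = j ∘ q₂ : Res_π C₂ → A₁`). [cite: Harari2020, §17.1 Thm. 17.2 (proof)]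
[cite: SerreLocalFields1979, Ch. XI §3] -/
theorem map_id_comp_map_quotientLayer (n : ℕ) :
    map (MonoidHom.id G₂) q₂ n ≫ map π j n = map π ι n ≫ map (MonoidHom.id G₁) q₁ n := by
  rw [← map_comp, ← map_comp]
  exact map_congr (MonoidHom.ext fun _ => rfl) (LinearMap.ext fun c => hsq c) n

include hsq in
/-- Elementwise form of `map_id_comp_map_quotientLayer`: `Inf_j (q₂ x) = q₁ (Inf_ι x)` on `Hⁿ`.
[cite: Harari2020, §17.1 Thm. 17.2 (proof)] -/
theorem map_quotientLayer_map_id_apply (n : ℕ) (x : groupCohomology C₂ n) :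
    map π j n (map (MonoidHom.id G₂) q₂ n x) = map (MonoidHom.id G₁) q₁ n (map π ι n x) := by
  rw [← CategoryTheory.comp_apply, map_id_comp_map_quotientLayer π ι q₂ q₁ j hsq n,
    CategoryTheory.comp_apply]

include hsq in
/-- **The tower law transfers to the quotient layers**: if `Inf_ι [φ₂] = d · [φ₁]` in `H²(G₁, C₁)` then
`Inf_j [q₂ ∘ φ₂] = d · [q₁ ∘ φ₁]` in `H²(G₁, A₁)` (Serre's `Inf(u_{F/E}) = [F':F]·u_{F'/E}` for the quotient
formation `C_S = C / U_S`). [cite: SerreLocalFields1979, Ch. XI §3] [cite: Harari2020, §17.1 Thm. 17.2] -/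
theorem map_H2π_mapCocycles₂_quotientLayer_eq_nsmul (φ₂ : cocycles₂ C₂) (φ₁ : cocycles₂ C₁) {d : ℕ}
    (hι : map π ι 2 (H2π C₂ φ₂) = d • H2π C₁ φ₁) :
    map π j 2 (H2π A₂ (mapCocycles₂ (MonoidHom.id G₂) q₂ φ₂)) =
      d • H2π A₁ (mapCocycles₂ (MonoidHom.id G₁) q₁ φ₁) := by
  rw [← H2π_comp_map_apply, ← H2π_comp_map_apply, map_quotientLayer_map_id_apply π ι q₂ q₁ j hsq, hι,
    map_nsmul]

include hsq in
/-- Class-level form: for ANY 2-cocycle `ψ₂` of `A₂` representing `H²(q₂)[φ₂]`, `Inf_j [ψ₂] = d · [q₁ ∘ φ₁]`.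
[cite: SerreLocalFields1979, Ch. XI §3] [cite: Harari2020, §17.1 Thm. 17.2] -/
theorem map_H2π_quotientLayer_eq_nsmul (φ₂ : cocycles₂ C₂) (φ₁ : cocycles₂ C₁) {d : ℕ}
    (hι : map π ι 2 (H2π C₂ φ₂) = d • H2π C₁ φ₁) {ψ₂ : cocycles₂ A₂}
    (hψ₂ : H2π A₂ ψ₂ = map (MonoidHom.id G₂) q₂ 2 (H2π C₂ φ₂)) :
    map π j 2 (H2π A₂ ψ₂) = d • H2π A₁ (mapCocycles₂ (MonoidHom.id G₁) q₁ φ₁) := by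
  rw [hψ₂, map_quotientLayer_map_id_apply π ι q₂ q₁ j hsq, hι, map_nsmul, H2π_comp_map_apply]

end General

/-! ## §2 Restriction of the two-layer data to subgroups `H₁ ≤ G₁`, `H₂ ≤ G₂` with `π(H₁) ≤ H₂` -/

section Subgroups

variable {k : Type u} [CommRing k] {G₁ G₂ : Type u} [Group G₁] [Group G₂] (π : G₁ →* G₂)
  {C₂ A₂ : Rep.{u} k G₂} {C₁ A₁ : Rep.{u} k G₁}
  (ι : Rep.res π C₂ ⟶ C₁) (q₂ : C₂ ⟶ A₂) (q₁ : C₁ ⟶ A₁) (j : Rep.res π A₂ ⟶ A₁)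
  (H₁ : Subgroup G₁) (H₂ : Subgroup G₂) (π' : H₁ →* H₂) (hπ' : ∀ h : H₁, ((π' h : H₂) : G₂) = π h)
  (ι' : Rep.res π' (Rep.res H₂.subtype C₂) ⟶ Rep.res H₁.subtype C₁) (hι' : ∀ c : C₂.V, ι'.hom c = ι.hom c)
  (j' : Rep.res π' (Rep.res H₂.subtype A₂) ⟶ Rep.res H₁.subtype A₁) (hj' : ∀ a : A₂.V, j'.hom a = j.hom a)

include hπ' hι' in
/-- **Restriction commutes with inflation** (morphism level): `Inf_ι ≫ res_{H₁} = res_{H₂} ≫ Inf_{ι'}` on `Hⁿ`, for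
the restricted layer map `π' : H₁ → H₂` (`π' = π` on elements) and `ι' = ι` on vectors (both composites are `Hⁿ`
along `H₁ → G₂` of the pair map `ι`; Mathlib's `groupCohomology.map_comp`).
[cite: Harari2020, §16.3 Lemma 16.20] [cite: SerreLocalFields1979, Ch. VII §6] -/
theorem map_comp_map_subtype_eq (n : ℕ) :
    map π ι n ≫ map H₁.subtype (𝟙 (Rep.res H₁.subtype C₁)) n =
      map H₂.subtype (𝟙 (Rep.res H₂.subtype C₂)) n ≫ map π' ι' n := by
  rw [← map_comp, ← map_comp, Category.comp_id, CategoryTheory.Functor.map_id]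
  erw [Category.id_comp]
  refine map_congr (MonoidHom.ext fun h => (hπ' h).symm) ?_ n
  rw [Rep.resMap_hom_toLinearMap]
  ext c
  rw [Representation.IntertwiningMap.toLinearMap_apply, Representation.IntertwiningMap.toLinearMap_apply]
  exact (hι' c).symm

include hπ' hι' in
/-- **Restriction commutes with inflation**: `res_{H₁} (Inf_ι x) = Inf_{ι'} (res_{H₂} x)` on `Hⁿ` (the relative
layers of Harari Lemma 16.20 at an open subgroup). [cite: Harari2020, §16.3 Lemma 16.20] -/
theorem map_subtype_map_eq_map_map_subtype (n : ℕ) (x : groupCohomology C₂ n) :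
    map H₁.subtype (𝟙 (Rep.res H₁.subtype C₁)) n (map π ι n x) =
      map π' ι' n (map H₂.subtype (𝟙 (Rep.res H₂.subtype C₂)) n x) := by
  rw [← CategoryTheory.comp_apply, map_comp_map_subtype_eq π ι H₁ H₂ π' hπ' ι' hι' n,
    CategoryTheory.comp_apply]

/-- Restriction commutes with the quotient maps (morphism level): `Hⁿ(q) ≫ res_H = res_H ≫ Hⁿ(q|)`.
[cite: Harari2020, §17.1 Thm. 17.2 (proof)] -/
theorem map_id_comp_map_subtype_eq (H : Subgroup G₂) (n : ℕ) :
    map (MonoidHom.id G₂) q₂ n ≫ map H.subtype (𝟙 (Rep.res H.subtype A₂)) n =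
      map H.subtype (𝟙 (Rep.res H.subtype C₂)) n ≫ map (MonoidHom.id H) (Rep.resMap H.subtype q₂) n := by
  rw [← map_comp, ← map_comp, Category.comp_id, CategoryTheory.Functor.map_id]
  erw [Category.id_comp]
  exact map_congr (MonoidHom.ext fun _ => rfl) (by rw [Rep.resMap_hom_toLinearMap]) n

/-- Restriction commutes with the quotient maps: `res_{H} (Hⁿ(q) x) = Hⁿ(q|) (res_{H} x)`.
[cite: Harari2020, §17.1 Thm. 17.2 (proof)] -/
theorem map_subtype_map_id_eq (H : Subgroup G₂) (n : ℕ) (x : groupCohomology C₂ n) :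
    map H.subtype (𝟙 (Rep.res H.subtype A₂)) n (map (MonoidHom.id G₂) q₂ n x) =
      map (MonoidHom.id H) (Rep.resMap H.subtype q₂) n (map H.subtype (𝟙 (Rep.res H.subtype C₂)) n x) := by
  rw [← CategoryTheory.comp_apply, map_id_comp_map_subtype_eq q₂ H n, CategoryTheory.comp_apply]

include hι' hj' in
/-- The commuting square restricts: `j' ∘ q₂| = q₁| ∘ ι'` on vectors. [cite: Harari2020, §17.1 Thm. 17.2 (proof)] -/
theorem quotientLayer_sq_res (hsq : ∀ c : C₂.V, j.hom (q₂.hom c) = q₁.hom (ι.hom c))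
    (c : (Rep.res H₂.subtype C₂).V) :
    j'.hom ((Rep.resMap H₂.subtype q₂).hom c) = (Rep.resMap H₁.subtype q₁).hom (ι'.hom c) := by
  rw [Rep.resMap_hom_apply, Rep.resMap_hom_apply, hj', hι']
  exact hsq c

include hπ' hι' in
/-- **The tower law restricts to the subgroups**: `Inf_ι [φ₂] = d · [φ₁]` implies
`Inf_{ι'} [res_{H₂} φ₂] = d · [res_{H₁} φ₁]` (the compatible fundamental classes of the relative layers).
[cite: Harari2020, §16.3 Lemma 16.20] [cite: SerreLocalFields1979, Ch. XI §3] -/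
theorem map_H2π_mapCocycles₂_subtype_eq_nsmul (φ₂ : cocycles₂ C₂) (φ₁ : cocycles₂ C₁) {d : ℕ}
    (hι : map π ι 2 (H2π C₂ φ₂) = d • H2π C₁ φ₁) :
    map π' ι' 2 (H2π (Rep.res H₂.subtype C₂) (mapCocycles₂ H₂.subtype (𝟙 (Rep.res H₂.subtype C₂)) φ₂)) =
      d • H2π (Rep.res H₁.subtype C₁) (mapCocycles₂ H₁.subtype (𝟙 (Rep.res H₁.subtype C₁)) φ₁) := by
  rw [H2π_mapCocycles₂_subtype, H2π_mapCocycles₂_subtype,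
    ← map_subtype_map_eq_map_map_subtype π ι H₁ H₂ π' hπ' ι' hι', hι, map_nsmul]

/-- A restricted quotient class represents the quotient of the restricted class: if `[ψ₂] = H²(q₂)[φ₂]` then
`[res_{H} ψ₂] = H²(q₂|)[res_{H} φ₂]`. [cite: Harari2020, §17.1 Thm. 17.2 (proof)] -/
theorem H2π_mapCocycles₂_subtype_quotientLayer (H : Subgroup G₂) (φ₂ : cocycles₂ C₂) {ψ₂ : cocycles₂ A₂}
    (hψ₂ : H2π A₂ ψ₂ = map (MonoidHom.id G₂) q₂ 2 (H2π C₂ φ₂)) :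
    H2π (Rep.res H.subtype A₂) (mapCocycles₂ H.subtype (𝟙 (Rep.res H.subtype A₂)) ψ₂) =
      map (MonoidHom.id H) (Rep.resMap H.subtype q₂) 2
        (H2π (Rep.res H.subtype C₂) (mapCocycles₂ H.subtype (𝟙 (Rep.res H.subtype C₂)) φ₂)) := by
  rw [H2π_mapCocycles₂_subtype, H2π_mapCocycles₂_subtype, hψ₂, map_subtype_map_id_eq q₂ H]

end Subgroups

/-! ## §3 Over `ℤ`, `G₂` finite: the quotient layer is a class module and the `ℓ`-part engine applies -/

section Integral

variable {G₁ G₂ : Type} [Group G₁] [Group G₂] [Fintype G₂] (π : G₁ →* G₂)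
  {C₂ A₂ : Rep.{0} ℤ G₂} {C₁ A₁ : Rep.{0} ℤ G₁}
  (ι : Rep.res π C₂ ⟶ C₁) (q₂ : C₂ ⟶ A₂) (q₁ : C₁ ⟶ A₁) (j : Rep.res π A₂ ⟶ A₁)
  (hsq : ∀ c : C₂.V, j.hom (q₂.hom c) = q₁.hom (ι.hom c))

/-- **The quotient layer is a class module with THE class `H²(q₂)[φ₂]`** when it satisfies the class-module
axioms numerically — I. `H¹(U, A₂) = 0` and II. `#H²(U, A₂) = #U` for every subgroup `U ≤ G₂` — and `H²(q₂)` is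
injective on `H²(G₂, ·)` (Harari's proof of Thm. 17.2: `U_S` cohomologically trivial makes `Hⁱ(·, C) → Hⁱ(·, C_S)`
bijective for `i ≥ 1`; Neukirch's criterion (7.3), the engine's `IsClassModule.of_card`, with the order of
`H²(q₂)[φ₂]` equal to that of `[φ₂]`, i.e. `|G₂|`).  Stated for any cocycle `ψ₂` representing `H²(q₂)[φ₂]`.
[cite: Harari2020, §17.1 Thm. 17.2 (proof), Prop. 15.40] -/
theorem IsClassModule.quotientLayer_of_card {φ₂ : cocycles₂ C₂} (hC : IsClassModule C₂ φ₂)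
    (h1 : ∀ U : Subgroup G₂, IsZero (groupCohomology (Rep.res U.subtype A₂) 1))
    (h2 : ∀ U : Subgroup G₂, Nat.card (groupCohomology (Rep.res U.subtype A₂) 2) = Nat.card U)
    (hinj : Function.Injective (map (MonoidHom.id G₂) q₂ 2)) {ψ₂ : cocycles₂ A₂}
    (hψ₂ : H2π A₂ ψ₂ = map (MonoidHom.id G₂) q₂ 2 (H2π C₂ φ₂)) : IsClassModule A₂ ψ₂ :=
  IsClassModule.of_card h1 h2 (by
    rw [hψ₂]
    have h := addOrderOf_injective (map (MonoidHom.id G₂) q₂ 2).hom.toAddMonoidHom (by exact hinj) (H2π C₂ φ₂)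
    exact h.trans hC.addOrderOf_H2π)

/-- In particular with the cocycle `q₂ ∘ φ₂` itself. [cite: Harari2020, §17.1 Thm. 17.2 (proof)] -/
theorem IsClassModule.quotientLayer_of_card_mapCocycles₂ {φ₂ : cocycles₂ C₂} (hC : IsClassModule C₂ φ₂)
    (h1 : ∀ U : Subgroup G₂, IsZero (groupCohomology (Rep.res U.subtype A₂) 1))
    (h2 : ∀ U : Subgroup G₂, Nat.card (groupCohomology (Rep.res U.subtype A₂) 2) = Nat.card U)
    (hinj : Function.Injective (map (MonoidHom.id G₂) q₂ 2)) :
    IsClassModule A₂ (mapCocycles₂ (MonoidHom.id G₂) q₂ φ₂) :=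
  hC.quotientLayer_of_card q₂ h1 h2 hinj (H2π_comp_map_apply (MonoidHom.id G₂) q₂ φ₂).symm

include hsq in
/-- **Milne I Lemma 1.9 on `ℓ`-parts for the quotient tower.**  If `(A₂, [ψ₂])` is a class module with
`[ψ₂] = H²(q₂)[φ₂]`, the `C`-tower law `Inf_ι [φ₂] = d · [φ₁]` holds and `e ∣ d`, then every
`y ∈ Hⁿ⁺³(G₂, A₂)` with `e · y = 0` has `Inf_j y = 0` in `Hⁿ⁺³(G₁, A₁)` (§1's transferred tower law fed to the
`ℓ`-part engine `IsClassModule.map_eq_zero_of_nsmul_eq_zero_plain`).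
[cite: MilneADT2006, Ch. I, Lemma 1.9] [cite: Harari2020, §16.3 Lemma 16.20, §17.1 Thm. 17.2] -/
theorem IsClassModule.map_quotientLayer_eq_zero_of_nsmul_eq_zero {φ₂ : cocycles₂ C₂} {ψ₂ : cocycles₂ A₂}
    (hA : IsClassModule A₂ ψ₂) (hψ₂ : H2π A₂ ψ₂ = map (MonoidHom.id G₂) q₂ 2 (H2π C₂ φ₂))
    (φ₁ : cocycles₂ C₁) {d e : ℕ} (hι : map π ι 2 (H2π C₂ φ₂) = d • H2π C₁ φ₁) (he : e ∣ d)
    (n : ℕ) (y : groupCohomology A₂ (n + 3)) (hy : e • y = 0) : map π j (n + 3) y = 0 :=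
  hA.map_eq_zero_of_nsmul_eq_zero_plain π j (mapCocycles₂ (MonoidHom.id G₁) q₁ φ₁)
    (map_H2π_quotientLayer_eq_nsmul π ι q₂ q₁ j hsq φ₂ φ₁ hι hψ₂) he n y hy

include hsq in
/-- `addOrderOf`-form: a quotient-layer class whose order divides the tower constant dies.
[cite: MilneADT2006, Ch. I, Lemma 1.9] [cite: Harari2020, §16.3 Lemma 16.20] -/
theorem IsClassModule.map_quotientLayer_eq_zero_of_addOrderOf_dvd {φ₂ : cocycles₂ C₂} {ψ₂ : cocycles₂ A₂}
    (hA : IsClassModule A₂ ψ₂) (hψ₂ : H2π A₂ ψ₂ = map (MonoidHom.id G₂) q₂ 2 (H2π C₂ φ₂))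
    (φ₁ : cocycles₂ C₁) {d : ℕ} (hι : map π ι 2 (H2π C₂ φ₂) = d • H2π C₁ φ₁)
    (n : ℕ) (y : groupCohomology A₂ (n + 3)) (hy : addOrderOf y ∣ d) : map π j (n + 3) y = 0 :=
  hA.map_quotientLayer_eq_zero_of_nsmul_eq_zero π ι q₂ q₁ j hsq hψ₂ φ₁ hι hy n y (addOrderOf_nsmul_eq_zero y)

variable (H₁ : Subgroup G₁) (H₂ : Subgroup G₂) (π' : H₁ →* H₂) (hπ' : ∀ h : H₁, ((π' h : H₂) : G₂) = π h)
  (ι' : Rep.res π' (Rep.res H₂.subtype C₂) ⟶ Rep.res H₁.subtype C₁) (hι' : ∀ c : C₂.V, ι'.hom c = ι.hom c)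
  (j' : Rep.res π' (Rep.res H₂.subtype A₂) ⟶ Rep.res H₁.subtype A₁) (hj' : ∀ a : A₂.V, j'.hom a = j.hom a)

omit [Fintype G₂] in
include hsq hπ' hι' hj' in
/-- **The relative form (subgroups `H₁ ≤ G₁`, `H₂ ≤ G₂`, `π(H₁) ≤ H₂`)**: if `(A₂, [ψ₂])` is a class module with
`[ψ₂] = H²(q₂)[φ₂]`, `Inf_ι [φ₂] = d · [φ₁]` and `e ∣ d`, then every `y ∈ Hⁿ⁺³(H₂, Res A₂)` with `e · y = 0` has
`Inf_{j'} y = 0` in `Hⁿ⁺³(H₁, Res A₁)` (the class module `(H₂, Res A₂, res [ψ₂])`, the restricted tower law of §2,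
and the `ℓ`-part engine) — the transition maps of the direct system `Hʳ(H_E, C_S(E))` computing `Hʳ(U, C̄_S)` at an
open subgroup `U` (Harari Lemma 16.20 / Milne I Lemma 1.9 at `U`, `P`-class-formation form).
[cite: MilneADT2006, Ch. I, Lemma 1.9] [cite: Harari2020, §16.3 Lemma 16.20, Remark 16.24 (b), §17.1 Thm. 17.2] -/
theorem IsClassModule.map_quotientLayer_res_eq_zero_of_nsmul_eq_zero [Fintype H₂] {φ₂ : cocycles₂ C₂}
    {ψ₂ : cocycles₂ A₂} (hA : IsClassModule A₂ ψ₂) (hψ₂ : H2π A₂ ψ₂ = map (MonoidHom.id G₂) q₂ 2 (H2π C₂ φ₂))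
    (φ₁ : cocycles₂ C₁) {d e : ℕ} (hι : map π ι 2 (H2π C₂ φ₂) = d • H2π C₁ φ₁) (he : e ∣ d) (n : ℕ)
    (y : groupCohomology (Rep.res H₂.subtype A₂) (n + 3)) (hy : e • y = 0) : map π' j' (n + 3) y = 0 :=
  (hA.res_mapCocycles₂ H₂).map_quotientLayer_eq_zero_of_nsmul_eq_zero π' ι' (Rep.resMap H₂.subtype q₂)
    (Rep.resMap H₁.subtype q₁) j' (quotientLayer_sq_res π ι q₂ q₁ j H₁ H₂ π' ι' hι' j' hj' hsq)
    (H2π_mapCocycles₂_subtype_quotientLayer q₂ H₂ φ₂ hψ₂)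
    (mapCocycles₂ H₁.subtype (𝟙 (Rep.res H₁.subtype C₁)) φ₁)
    (map_H2π_mapCocycles₂_subtype_eq_nsmul π ι H₁ H₂ π' hπ' ι' hι' φ₂ φ₁ hι) he n y hy

omit [Fintype G₂] in
include hsq hπ' hι' hj' in
/-- `addOrderOf`-form of the relative statement. [cite: MilneADT2006, Ch. I, Lemma 1.9]
[cite: Harari2020, §16.3 Lemma 16.20] -/
theorem IsClassModule.map_quotientLayer_res_eq_zero_of_addOrderOf_dvd [Fintype H₂] {φ₂ : cocycles₂ C₂}
    {ψ₂ : cocycles₂ A₂} (hA : IsClassModule A₂ ψ₂) (hψ₂ : H2π A₂ ψ₂ = map (MonoidHom.id G₂) q₂ 2 (H2π C₂ φ₂))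
    (φ₁ : cocycles₂ C₁) {d : ℕ} (hι : map π ι 2 (H2π C₂ φ₂) = d • H2π C₁ φ₁) (n : ℕ)
    (y : groupCohomology (Rep.res H₂.subtype A₂) (n + 3)) (hy : addOrderOf y ∣ d) :
    map π' j' (n + 3) y = 0 :=
  hA.map_quotientLayer_res_eq_zero_of_nsmul_eq_zero π ι q₂ q₁ j hsq H₁ H₂ π' hπ' ι' hι' j' hj' hψ₂ φ₁ hι hy
    n y (addOrderOf_nsmul_eq_zero y)

end Integral

end Literature.Algebra.Homology

end
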